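import Summits.QuantumFields.YangMills.Theorems.AlphaInputsT3ACAnnulusGapOfB0
import HarnessLib

/-!
# `AlphaInputsT3ACAnnulusGapSizing` — THE SIZE OF THE (★3) GAP TERM `|Plaq_k|·e^{−p(g_{K−k})²∕(4B²)}·Λund` UNDER THE FLAT-MODEL SHAPE OF THE B0 UNDAMPING CONSTANT
# `Λund ≤ (A∕g_{K−k})^ν` (RECORD 17ee's last sentence «`r_k` superpolynomially small once `b₀² ≥ 4·max(B₃,1)²·(K′ + ν_L)`», typed): cell ym3-torus, crux `HistoryTailL`
# (stmt-QuantumFields-19936); seat ym-ust-19936-w8 g18; helper `--supports stmt-QuantumFields-19936`; sequel of ✓p783651 `…AnnulusGapOfB0`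

WHAT.  §1 ★`exp_neg_scaled_pFun_sq_le_pow`: `e^{−(c²∕4)·p(g)²} ≤ g^N` once `N ≤ (c²∕2)·b₀²` (`0 < g ≤ 1`, `p₀ ≥ 1`) — [Balaban1985UV3] (11) «smaller than any positive power of ε»,
lit ✓`B10.smallFactor_le_pow` read at `b₀ ↦ (c∕√2)·b₀` through ✓`pFun_mul`.  §2 ★`card_plaq_T3_eq`: `|Plaq_k(F.P K)| = 24·L^{3m}·(L^{K−k})³` and ★`card_plaq_T3_eq_gk`: `= 24·L^{3m}·γ³·g⁻⁶`,
`g := √(γ·L^{−(K−k)})`.  §3 ★★`annulusGapTerm_le`: with `Λund ≤ (A∕g)^ν` (`0 ≤ A`, the flat-model shape of px8 g17's letter 8538b781) and `ν + 6 + K′ ≤ (c²∕2)·b₀²`: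
`|Plaq_k|·(e^{−(c²∕4)p(g)²}·Λund) ≤ 24·L^{3m}·γ³·A^ν·g^{K′}` and ★★`log_one_add_annulusGapTerm_le`: `log(1 + |Plaq_k|·(e^{−(c²∕4)p(g)²}·Λund)) ≤ 24·L^{3m}·γ³·A^ν·g^{K′}`.
§4 ★★★`log_gap_le_of_B0_chiB_sized`: ✓`AlphaInputsT3AC.log_gap_le_of_B0_chiB` (p783651) with its gap term so sized — display = {`hθ1`, `hθ2`, `hint`, `hintU`, `hund`, `hb`, `hb₁`} +
{`hΛ : Λund ≤ (A∕g_{K−k})^ν`, `hN : ν + 6 + K′ ≤ b₀²∕(2·max(B₃,1)²)`}; conclusion `log ∫χB·G ≤ log ∫χB·𝟙[loPrintAC k](Ψ·)·G + 24·L^{3m}·γ³·A^ν·g_{K−k}^{K′}`.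
§5 ★`sum_sqrt_coupling_pow_le`: `Σ_{n<N} √(γ·L^{−n})^{K′} ≤ √γ^{K′}∕(1 − √(L⁻¹)^{K′})` (`K′ ≥ 1`, `L > 1`) — the `r_k` are summable over the run, uniformly in `K` (what 20520's two-sided tilt consumes).

HONEST SCOPE.  Arithmetic over landed helpers; **`hΛ` is a HYPOTHESIS on the B0 constant; the VALUE of `Λund` stays B0's (docket (R7), ≥ 09-02)** (★★OWNER g39 WORD №183 (ii));
its flat-model shape `(A∕g)^ν` with `A, ν` `k`-FREE is px8 g17's letter 8538b781 gloss (the curved∕χ-window bookkeeping is B0 content NOT in tree); nothing of (★3)'s B0 content, #22∕#23, (O‴χₛ), `HistoryTailL` (19936), EX, 19200, 20520, `YM3TorusSU2` proved; def-free; count-neutral; registry `unbundled_v6` fc7786ec untouched.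
Rung R3 = SU(2) YM₃ on T³ — not d = 4, not infinite volume, not a mass gap, not Clay; the Yang–Mills mass gap is NOT proved.
References: T. Bałaban, Commun. Math. Phys. 102 (1985) 255–275 [Balaban1985UV3] ((5) p.256, (7) p.257, (11) p.258, (67)–(71) p.273).
-/

set_option autoImplicit false

noncomputable section

open scoped BigOperators

namespace Summit.QuantumFields.YangMills.Theorems

open MeasureTheory Literature.MathematicalPhysics.QuantumFieldTheory.Balaban1983to89
open Literature.MathematicalPhysics.QuantumFieldTheory.Balaban1983to89.T3ContinuumYM3Torus
open Literature.MathematicalPhysics.QuantumFieldTheory.Balaban1983to89.T3UnitLawDensityEML (ℰp)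
open Literature.MathematicalPhysics.QuantumFieldTheory.Balaban1983to89.T3UnitScaleTilt (θBal)
open Literature.MathematicalPhysics.QuantumFieldTheory.Balaban1983to89.B10Eq38TorusDomains (toFine)
open Literature.MathematicalPhysics.QuantumFieldTheory.Balaban1985CMP102 Literature.MathematicalPhysics.QuantumFieldTheory.Balaban1985CMP102.Setting
open Summit.QuantumFields.Balaban3D.Carriers
open Summit.QuantumFields.Balaban3D.Proofs.Primitives
open Summit.QuantumFields.Balaban3D.Proofs.TowerAC Summit.QuantumFields.Balaban3D.Proofs.StandardAC Summit.QuantumFields.Balaban3D.Proofs.InputsAC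
open Summit.QuantumFields.Balaban3D.Proofs.Bound55Masses (chiB)
open Summit.QuantumFields.YangMills.Theorems.HistoryTailOfLocalStability (pFun_mul)

namespace AlphaInputsT3AC

/-! ## §1 (11): the scaled small factor is below any power of the coupling -/

/-- ★ **`e^{−(c²∕4)p(g)²} ≤ g^N` once `N ≤ (c²∕2)·b₀²`** (`0 ≤ b₀`, `1 ≤ p₀`, `0 < c`, `0 < g ≤ 1`): lit ✓`B10.smallFactor_le_pow` at `b₀ ↦ (c∕√2)·b₀`, since print's profile is linear in `b₀`
(`(c²∕4)·p_{b₀}(g)² = ½·p_{(c∕√2)b₀}(g)²`). [cite: Balaban1985UV3, (11) p.258] -/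
theorem exp_neg_scaled_pFun_sq_le_pow {b₀ p₀ c g : ℝ} (N : ℕ) (hb : 0 ≤ b₀) (hp : 1 ≤ p₀) (hc : 0 < c) (hg : 0 < g) (hg1 : g ≤ 1)
    (hN : (N : ℝ) ≤ c ^ 2 / 2 * b₀ ^ 2) :
    Real.exp (-(c ^ 2 / 4 * B10.pFun b₀ p₀ g ^ 2)) ≤ g ^ N := by
  have h2 : (0 : ℝ) < Real.sqrt 2 := Real.sqrt_pos.mpr two_pos
  have hsq : Real.sqrt 2 ^ 2 = 2 := Real.sq_sqrt two_pos.le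
  have hk : 0 ≤ c / Real.sqrt 2 * b₀ := mul_nonneg (div_nonneg hc.le h2.le) hb
  have hN' : (N : ℝ) ≤ (c / Real.sqrt 2 * b₀) ^ 2 := by
    rw [mul_pow, div_pow, hsq]; linarith
  have h := B10.smallFactor_le_pow (c / Real.sqrt 2 * b₀) p₀ g N hk hN' hp hg hg1
  rw [pFun_mul] at h
  have e : -(1 / 2) * (c / Real.sqrt 2 * B10.pFun b₀ p₀ g) ^ 2 = -(c ^ 2 / 4 * B10.pFun b₀ p₀ g ^ 2) := by
    rw [mul_pow, div_pow, hsq]; ring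
  rwa [e] at h

/-! ## §2 The plaquette count of the level-`k` torus of the `K`-th approximation -/

/-- ★ **`|Plaq_k(F.P K)| = 24·L^{3m}·(L^{K−k})³`** (`k ≤ K`; three plaquettes per site, `2L^{m+K−k}` sites per direction). [cite: Balaban1985UV3, (5) p.256] -/
theorem card_plaq_T3_eq (F : T3Family) (K k : ℕ) (hk : k ≤ K) :
    (Fintype.card (Plaq (F.P K) k) : ℝ) = 24 * (F.L : ℝ) ^ (3 * F.m) * ((F.L : ℝ) ^ (K - k)) ^ 3 := by
  rw [B10Eq41TorusHistories.card_plaq_three (F.P_d K), Site.card_site]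
  have hsp : (F.P K).sitesPerDir k = 2 * F.L ^ (F.m + K - k) := rfl
  rw [hsp, F.P_d]
  push_cast
  have e : F.m + K - k = F.m + (K - k) := by omega
  rw [e, pow_add]
  ring

/-- ★ **`|Plaq_k(F.P K)| = 24·L^{3m}·γ³·g⁻⁶`** with `g := √(γ·L^{−(K−k)})` the coupling at distance `K − k` from the unit scale (`0 < γ`). [cite: Balaban1985UV3, (3) p.256 and (5) p.256] -/
theorem card_plaq_T3_eq_gk (F : T3Family) {γ : ℝ} (hγ : 0 < γ) (K k : ℕ) (hk : k ≤ K) :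
    (Fintype.card (Plaq (F.P K) k) : ℝ) = 24 * (F.L : ℝ) ^ (3 * F.m) * γ ^ 3 * (Real.sqrt (γ * ((F.L : ℝ)⁻¹) ^ (K - k)))⁻¹ ^ 6 := by
  have hL : (0 : ℝ) < F.L := by exact_mod_cast (zero_lt_one.trans F.hL.2)
  have hLk : (0 : ℝ) < (F.L : ℝ) ^ (K - k) := pow_pos hL _
  set x : ℝ := γ * ((F.L : ℝ)⁻¹) ^ (K - k) with hxdef
  have hxL : x = γ * ((F.L : ℝ) ^ (K - k))⁻¹ := by rw [hxdef, inv_pow]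
  have hx : 0 < x := by rw [hxL]; exact mul_pos hγ (inv_pos.mpr hLk)
  have hsq : Real.sqrt x ^ 2 = x := Real.sq_sqrt hx.le
  have h6 : (Real.sqrt x)⁻¹ ^ 6 = (x ^ 3)⁻¹ := by
    rw [inv_pow (Real.sqrt x) 6, show (6 : ℕ) = 2 * 3 from rfl, pow_mul, hsq]
  rw [card_plaq_T3_eq F K k hk, h6, hxL, mul_pow, mul_inv, inv_pow, inv_inv]
  field_simp

/-! ## §3 The gap term under the flat-model shape of `Λund` -/

/-- ★★ **THE SIZE OF THE GAP TERM**: with `g := √(γ·L^{−(K−k)}) ∈ (0, 1]`, `Λund ≤ (A∕g)^ν` (`0 ≤ A`), `0 ≤ b₀`, `1 ≤ p₀`, `0 < c` and `ν + 6 + K′ ≤ (c²∕2)·b₀²`: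
`|Plaq_k|·(e^{−(c²∕4)p(g)²}·Λund) ≤ 24·L^{3m}·γ³·A^ν·g^{K′}`. [cite: Balaban1985UV3, (11) p.258 and (71) p.273] -/
theorem annulusGapTerm_le (F : T3Family) {γ : ℝ} (hγ : 0 < γ) (K k : ℕ) (hk : k ≤ K)
    {b₀ p₀ c : ℝ} (hb : 0 ≤ b₀) (hp : 1 ≤ p₀) (hc : 0 < c)
    (hg1 : Real.sqrt (γ * ((F.L : ℝ)⁻¹) ^ (K - k)) ≤ 1)
    {Λund A : ℝ} {ν K' : ℕ} (hA : 0 ≤ A) (hΛ : Λund ≤ (A / Real.sqrt (γ * ((F.L : ℝ)⁻¹) ^ (K - k))) ^ ν)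
    (hN : ((ν + 6 + K' : ℕ) : ℝ) ≤ c ^ 2 / 2 * b₀ ^ 2) :
    (Fintype.card (Plaq (F.P K) k) : ℝ) * (Real.exp (-(c ^ 2 / 4 * B10.pFun b₀ p₀ (Real.sqrt (γ * ((F.L : ℝ)⁻¹) ^ (K - k))) ^ 2)) * Λund) ≤
      24 * (F.L : ℝ) ^ (3 * F.m) * γ ^ 3 * A ^ ν * Real.sqrt (γ * ((F.L : ℝ)⁻¹) ^ (K - k)) ^ K' := by
  set g : ℝ := Real.sqrt (γ * ((F.L : ℝ)⁻¹) ^ (K - k)) with hgdef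
  have hL : (0 : ℝ) < F.L := by exact_mod_cast (zero_lt_one.trans F.hL.2)
  have hg : 0 < g := Real.sqrt_pos.mpr (mul_pos hγ (pow_pos (inv_pos.mpr hL) _))
  have hexp : Real.exp (-(c ^ 2 / 4 * B10.pFun b₀ p₀ g ^ 2)) ≤ g ^ (ν + 6 + K') := exp_neg_scaled_pFun_sq_le_pow _ hb hp hc hg hg1 hN
  have hΛ0 : (0 : ℝ) ≤ (A / g) ^ ν := pow_nonneg (div_nonneg hA hg.le) _
  have hcard : (Fintype.card (Plaq (F.P K) k) : ℝ) = 24 * (F.L : ℝ) ^ (3 * F.m) * γ ^ 3 * g⁻¹ ^ 6 := card_plaq_T3_eq_gk F hγ K k hk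
  have hC0 : (0 : ℝ) ≤ 24 * (F.L : ℝ) ^ (3 * F.m) * γ ^ 3 * g⁻¹ ^ 6 := by positivity
  -- `e^{−E}·Λund ≤ g^{ν+6+K′}·(A∕g)^ν`
  have h1 : Real.exp (-(c ^ 2 / 4 * B10.pFun b₀ p₀ g ^ 2)) * Λund ≤ g ^ (ν + 6 + K') * (A / g) ^ ν := by
    by_cases hΛn : 0 ≤ Λund
    · exact mul_le_mul hexp hΛ hΛn (pow_nonneg hg.le _)
    · exact le_trans (mul_nonpos_iff.mpr (Or.inl ⟨(Real.exp_pos _).le, (lt_of_not_ge hΛn).le⟩)) (mul_nonneg (pow_nonneg hg.le _) hΛ0)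
  rw [hcard]
  calc 24 * (F.L : ℝ) ^ (3 * F.m) * γ ^ 3 * g⁻¹ ^ 6 * (Real.exp (-(c ^ 2 / 4 * B10.pFun b₀ p₀ g ^ 2)) * Λund)
      ≤ 24 * (F.L : ℝ) ^ (3 * F.m) * γ ^ 3 * g⁻¹ ^ 6 * (g ^ (ν + 6 + K') * (A / g) ^ ν) := mul_le_mul_of_nonneg_left h1 hC0
    _ = 24 * (F.L : ℝ) ^ (3 * F.m) * γ ^ 3 * A ^ ν * g ^ K' := by
        rw [div_pow, pow_add, pow_add]; field_simp
  
/-- ★★ **THE `r_k` OF RECORD 17ee IS SMALL**: `log(1 + |Plaq_k|·(e^{−(c²∕4)p(g)²}·Λund)) ≤ 24·L^{3m}·γ³·A^ν·g^{K′}` under §3's hypotheses and `0 ≤ Λund` (`log(1+x) ≤ x`).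
[cite: Balaban1985UV3, (11) p.258 and (71) p.273] -/
theorem log_one_add_annulusGapTerm_le (F : T3Family) {γ : ℝ} (hγ : 0 < γ) (K k : ℕ) (hk : k ≤ K)
    {b₀ p₀ c : ℝ} (hb : 0 ≤ b₀) (hp : 1 ≤ p₀) (hc : 0 < c)
    (hg1 : Real.sqrt (γ * ((F.L : ℝ)⁻¹) ^ (K - k)) ≤ 1)
    {Λund A : ℝ} {ν K' : ℕ} (hΛ0 : 0 ≤ Λund) (hA : 0 ≤ A) (hΛ : Λund ≤ (A / Real.sqrt (γ * ((F.L : ℝ)⁻¹) ^ (K - k))) ^ ν)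
    (hN : ((ν + 6 + K' : ℕ) : ℝ) ≤ c ^ 2 / 2 * b₀ ^ 2) :
    Real.log (1 + (Fintype.card (Plaq (F.P K) k) : ℝ) *
        (Real.exp (-(c ^ 2 / 4 * B10.pFun b₀ p₀ (Real.sqrt (γ * ((F.L : ℝ)⁻¹) ^ (K - k))) ^ 2)) * Λund)) ≤
      24 * (F.L : ℝ) ^ (3 * F.m) * γ ^ 3 * A ^ ν * Real.sqrt (γ * ((F.L : ℝ)⁻¹) ^ (K - k)) ^ K' := by
  set T : ℝ := (Fintype.card (Plaq (F.P K) k) : ℝ) *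
      (Real.exp (-(c ^ 2 / 4 * B10.pFun b₀ p₀ (Real.sqrt (γ * ((F.L : ℝ)⁻¹) ^ (K - k))) ^ 2)) * Λund) with hT
  have hx : 0 ≤ T := mul_nonneg (Nat.cast_nonneg _) (mul_nonneg (Real.exp_pos _).le hΛ0)
  refine le_trans ?_ (annulusGapTerm_le F hγ K k hk hb hp hc hg1 hA hΛ hN)
  have h := Real.log_le_sub_one_of_pos (x := 1 + T) (by linarith)
  linarith

/-! ## §4 The (★3) gap at the pin's `χB`, SIZED -/

variable {F : T3Family} {𝔠 : AlphaConsts F.L (suGroupModel 2).N} {γ : ℝ} {hγ : 0 < γ} {hγ1 : γ ≤ (min 𝔠.gamma0 1) ^ 2}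

/-- The coupling at distance `n` from the unit scale is at most `1` (`γ ≤ 1`, `L ≥ 1`). [cite: Balaban1985UV3, (3) p.256] -/
theorem sqrt_gamma_pow_le_one (F : T3Family) {γ : ℝ} (hγ1 : γ ≤ 1) (n : ℕ) :
    Real.sqrt (γ * ((F.L : ℝ)⁻¹) ^ n) ≤ 1 := by
  have hL : (1 : ℝ) ≤ F.L := by exact_mod_cast (le_of_lt F.hL.2)
  have h1 : ((F.L : ℝ)⁻¹) ^ n ≤ 1 := pow_le_one₀ (inv_nonneg.mpr (zero_le_one.trans hL)) (inv_le_one_of_one_le₀ hL)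
  rw [Real.sqrt_le_one]
  calc γ * ((F.L : ℝ)⁻¹) ^ n ≤ 1 * 1 := mul_le_mul hγ1 h1 (pow_nonneg (inv_nonneg.mpr (zero_le_one.trans hL)) _) zero_le_one
    _ = 1 := one_mul _

open Classical in
/-- ★★★ **THE (★3) GAP AT THE PIN'S SMALL-FIELD FACTOR, SIZED**: ✓`AlphaInputsT3AC.log_gap_le_of_B0_chiB` (p783651) followed by §3 — under the B0 letters {`hund`, `0 < b ≤ bulk`}, the
integrability pair, the γ-regime pair (✓`exists_gamma_quarter_regime_scaled`), the flat-model SHAPE of the undamping constant `hΛ : Λund ≤ (A∕g_{K−k})^ν` (`0 ≤ Λund`, `0 ≤ A`) and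
the profile floor `hN : ν + 6 + K′ ≤ b₀²∕(2·max(B₃,1)²)`:
`log ∫χB·G ≤ log ∫χB·𝟙[loPrintAC k](Ψ·)·G + 24·L^{3m}·γ³·A^ν·g_{K−k}^{K′}` — RECORD 17ee's `r_k`, superpolynomially small in the coupling. [cite: Balaban1985UV3, (11) p.258 and (67)-(71) p.273] -/
theorem log_gap_le_of_B0_chiB_sized (qf : ∀ K, AlphaInputsT3AC.PkgCoreRows F 𝔠 γ hγ hγ1 K) (K : ℕ)
    (ha₁ : ∀ i, θBal F.L γ 𝔠.b₀ 𝔠.p₀ i ≤ (qf K).a₁) (k : ℕ) (hk : k ≤ K)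
    (hθ1 : ((((3 + 2) * F.L : ℕ) : ℝ) ^ 2 / 4) * (𝔠.C68 * θBal F.L γ 𝔠.b₀ 𝔠.p₀ (K - k)) ≤ 1 / 10)
    (hθ2 : 540 * (435 ^ 2 * (𝔠.C68 * (((3 + 2) * F.L : ℕ) : ℝ) ^ 2 / 4) ^ 4) * θBal F.L γ 𝔠.b₀ 𝔠.p₀ (K - k) ^ 2 ≤ (1 / max 𝔠.B₃ 1) ^ 2 / 4)
    {β : Type*} [MeasurableSpace β] (μ : Measure β)
    (Ψ : β → GaugeField (F.P K) k (Matrix.specialUnitaryGroup (Fin 2) ℂ)) (hΨ : Measurable Ψ)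
    {G : β → ℝ} (hG : ∀ x, 0 ≤ G x)
    (hint : Integrable (fun x =>
      chiB 𝔠.lane.carrier.M₁ (rcolOf (T3Scales F γ hγ (hγ1.trans (sq_min_one_le _ 𝔠.gamma0_pos)) K) 𝔠.lane.carrier)
        (eps1Of (T3Scales F γ hγ (hγ1.trans (sq_min_one_le _ 𝔠.gamma0_pos)) K) 𝔠.lane.carrier) k (Hist.triv (F.P K) (k + 1)) (Ψ x) * G x) μ)
    {Λund b : ℝ}
    (hintU : ∀ p : Plaq (F.P K) k, Integrable (fun x =>
      chiB 𝔠.lane.carrier.M₁ (rcolOf (T3Scales F γ hγ (hγ1.trans (sq_min_one_le _ 𝔠.gamma0_pos)) K) 𝔠.lane.carrier)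
        (eps1Of (T3Scales F γ hγ (hγ1.trans (sq_min_one_le _ 𝔠.gamma0_pos)) K) 𝔠.lane.carrier) k (Hist.triv (F.P K) (k + 1)) (Ψ x) *
      (Real.exp ((F.scheme ℰp γ).β K *
          ∑ q ∈ Finset.univ.filter (fun q : Plaq (F.P K) 0 => ∀ ι, ∃ e : ℤ, |e| ≤ 3 * (((F.P K).L : ℤ) ^ k - 1) ∧
            q.src ι = toFine k p.src ι + (e : ZMod ((F.P K).sitesPerDir 0))),
            (1 - reTr (GaugeField.plaqHol ((qf K).UkH k (Hist.triv (F.P K) k) (Ψ x)) q))) * G x)) μ)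
    (hund : ∀ p : Plaq (F.P K) k, ∫ x,
      chiB 𝔠.lane.carrier.M₁ (rcolOf (T3Scales F γ hγ (hγ1.trans (sq_min_one_le _ 𝔠.gamma0_pos)) K) 𝔠.lane.carrier)
        (eps1Of (T3Scales F γ hγ (hγ1.trans (sq_min_one_le _ 𝔠.gamma0_pos)) K) 𝔠.lane.carrier) k (Hist.triv (F.P K) (k + 1)) (Ψ x) *
      (Real.exp ((F.scheme ℰp γ).β K *
          ∑ q ∈ Finset.univ.filter (fun q : Plaq (F.P K) 0 => ∀ ι, ∃ e : ℤ, |e| ≤ 3 * (((F.P K).L : ℤ) ^ k - 1) ∧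
            q.src ι = toFine k p.src ι + (e : ZMod ((F.P K).sitesPerDir 0))),
            (1 - reTr (GaugeField.plaqHol ((qf K).UkH k (Hist.triv (F.P K) k) (Ψ x)) q))) * G x) ∂μ ≤ Λund * b)
    (hb : 0 < b)
    (hb₁ : b ≤ ∫ x,
      chiB 𝔠.lane.carrier.M₁ (rcolOf (T3Scales F γ hγ (hγ1.trans (sq_min_one_le _ 𝔠.gamma0_pos)) K) 𝔠.lane.carrier)
        (eps1Of (T3Scales F γ hγ (hγ1.trans (sq_min_one_le _ 𝔠.gamma0_pos)) K) 𝔠.lane.carrier) k (Hist.triv (F.P K) (k + 1)) (Ψ x) *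
      (PinnedStep.loPrintAC 𝔠.lane (qf K).X k).indicator (fun _ => (1 : ℝ)) (Ψ x) * G x ∂μ)
    {A : ℝ} {ν K' : ℕ} (hΛ0 : 0 ≤ Λund) (hA : 0 ≤ A)
    (hΛ : Λund ≤ (A / Real.sqrt (γ * ((F.L : ℝ)⁻¹) ^ (K - k))) ^ ν)
    (hN : ((ν + 6 + K' : ℕ) : ℝ) ≤ (1 / max 𝔠.B₃ 1) ^ 2 / 2 * 𝔠.b₀ ^ 2) :
    Real.log (∫ x,
      chiB 𝔠.lane.carrier.M₁ (rcolOf (T3Scales F γ hγ (hγ1.trans (sq_min_one_le _ 𝔠.gamma0_pos)) K) 𝔠.lane.carrier)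
        (eps1Of (T3Scales F γ hγ (hγ1.trans (sq_min_one_le _ 𝔠.gamma0_pos)) K) 𝔠.lane.carrier) k (Hist.triv (F.P K) (k + 1)) (Ψ x) * G x ∂μ) ≤
      Real.log (∫ x,
        chiB 𝔠.lane.carrier.M₁ (rcolOf (T3Scales F γ hγ (hγ1.trans (sq_min_one_le _ 𝔠.gamma0_pos)) K) 𝔠.lane.carrier)
          (eps1Of (T3Scales F γ hγ (hγ1.trans (sq_min_one_le _ 𝔠.gamma0_pos)) K) 𝔠.lane.carrier) k (Hist.triv (F.P K) (k + 1)) (Ψ x) *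
        (PinnedStep.loPrintAC 𝔠.lane (qf K).X k).indicator (fun _ => (1 : ℝ)) (Ψ x) * G x ∂μ)
        + 24 * (F.L : ℝ) ^ (3 * F.m) * γ ^ 3 * A ^ ν * Real.sqrt (γ * ((F.L : ℝ)⁻¹) ^ (K - k)) ^ K' := by
  have hγ1' : γ ≤ 1 := hγ1.trans (sq_min_one_le _ 𝔠.gamma0_pos)
  have h := log_gap_le_of_B0_chiB qf K ha₁ k hk hθ1 hθ2 μ Ψ hΨ hG hint hintU hund hb hb₁
  have hs := log_one_add_annulusGapTerm_le F hγ K k hk 𝔠.b₀_pos.le (le_of_lt (lt_trans one_lt_two 𝔠.two_lt_p₀))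
    (c := 1 / max 𝔠.B₃ 1) (by positivity) (sqrt_gamma_pow_le_one F hγ1' (K - k)) hΛ0 hA hΛ hN
  linarith


/-! ## §5 Summability of the sized gap terms over the run, uniformly in `K` -/

/-- ★ **`Σ_{n<N} √(γ·L^{−n})^{K′} ≤ √γ^{K′}∕(1 − √(L⁻¹)^{K′})`** (`0 ≤ γ`, `1 < L`, `1 ≤ K′`): a geometric series in `(1∕√L)^{K′} < 1` (Mathlib `geom_sum_Ico_le_of_lt_one`), so the
sized `r_k ≤ C·g_{K−k}^{K′}` of §3–§4 sum over `k ≤ K` to at most `C·√γ^{K′}∕(1 − L^{−K′∕2})`, independently of `K`. [cite: Balaban1985UV3, (3) p.256 and (11) p.258] -/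
theorem sum_sqrt_coupling_pow_le {L : ℕ} (hL : 1 < L) {γ : ℝ} (hγ : 0 ≤ γ) {K' : ℕ} (hK' : 1 ≤ K') (N : ℕ) :
    ∑ n ∈ Finset.range N, Real.sqrt (γ * ((L : ℝ)⁻¹) ^ n) ^ K' ≤ Real.sqrt γ ^ K' / (1 - Real.sqrt ((L : ℝ)⁻¹) ^ K') := by
  have hL1 : (1 : ℝ) < L := by exact_mod_cast hL
  have hx0 : (0 : ℝ) ≤ (L : ℝ)⁻¹ := inv_nonneg.mpr (zero_le_one.trans hL1.le)
  have hx1 : (L : ℝ)⁻¹ < 1 := inv_lt_one_of_one_lt₀ hL1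
  set r : ℝ := Real.sqrt ((L : ℝ)⁻¹) ^ K' with hr
  have hs1 : Real.sqrt ((L : ℝ)⁻¹) < 1 := (Real.sqrt_lt' one_pos).mpr (by rw [one_pow]; exact hx1)
  have hr0 : 0 ≤ r := pow_nonneg (Real.sqrt_nonneg _) _
  have hr1 : r < 1 := pow_lt_one₀ (Real.sqrt_nonneg _) hs1 (by omega)
  -- termwise: `√(γ·x^n)^{K′} = √γ^{K′}·r^n`
  have hterm : ∀ n, Real.sqrt (γ * ((L : ℝ)⁻¹) ^ n) ^ K' = Real.sqrt γ ^ K' * r ^ n := by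
    intro n
    have hxn : Real.sqrt (((L : ℝ)⁻¹) ^ n) = Real.sqrt ((L : ℝ)⁻¹) ^ n := by
      rw [show ((L : ℝ)⁻¹) ^ n = (Real.sqrt ((L : ℝ)⁻¹) ^ n) ^ 2 by rw [← pow_mul, mul_comm, pow_mul, Real.sq_sqrt hx0],
        Real.sqrt_sq (pow_nonneg (Real.sqrt_nonneg _) _)]
    rw [Real.sqrt_mul hγ, hxn, mul_pow, hr, ← pow_mul, ← pow_mul, mul_comm n K']
  simp_rw [hterm]
  rw [← Finset.mul_sum, div_eq_mul_inv]
  refine mul_le_mul_of_nonneg_left ?_ (pow_nonneg (Real.sqrt_nonneg _) _)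
  have h := geom_sum_Ico_le_of_lt_one hr0 hr1 (m := 0) (n := N)
  rw [pow_zero, one_div] at h
  rwa [Finset.range_eq_Ico]


end AlphaInputsT3AC

end Summit.QuantumFields.YangMills.Theorems

end
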